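import Mathlib
import HarnessLib

/-!
# The Dirichlet problem on a disc: the Poisson integral of continuous boundary data

Topic `Literature/Analysis/Complex` (classical potential theory in the plane). Mathlib has the
Poisson kernel `poissonKernel c w z = (|z-c|² - |w-c|²)/|z-w|²` of the disc `B(c, R)`, the
**representation** half of the theory (`HarmonicContOnCl.circleAverage_poissonKernel_smul`: a
function harmonic on the disc and continuous on the closed disc is the Poisson integral of its
boundary values) and the kernel bounds `re_herglotzRieszKernel_le` / `le_re_herglotzRieszKernel`,
but not the **existence** half: for CONTINUOUS data `φ` on the circle `|z - c| = R`, the Poisson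
integral

  `u(w) = (2π)⁻¹ ∫₀^{2π} P(w, c + Re^{iθ}) φ(c + Re^{iθ}) dθ`  (`|w - c| < R`),  `u = φ` on the circle,

is harmonic in the open disc and continuous on the closed disc (H. A. Schwarz 1872; e.g.
T. Ransford, *Potential Theory in the Complex Plane* (1995), Thm. 1.2.4; L. Ahlfors, *Complex
Analysis*, Ch. 4 §6.4). This file proves it:

* `discPoisson c R φ` — the function above (the Poisson integral inside, `φ` outside the open disc);
* `discPoisson_eq_re` / `harmonicOnNhd_discPoisson` — inside the disc `u = Re F` with
  `F(w) = 2·(2πi)⁻¹∮ φ(z)(z-w)⁻¹ dz - avg φ` holomorphic (Mathlib's power series of Cauchy integrals,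
  `hasFPowerSeriesOn_cauchy_integral`), so `u` is harmonic;
* `abs_discPoisson_sub_le` — the approximate-identity estimate
  `|u(w) - φ(ζ)| ≤ ε + 8M(R² - |w-c|²)/η²` for `|w - ζ| ≤ η/2`, where `|φ - φ(ζ)| ≤ ε` on the
  circle within `η` of `ζ` and `|φ| ≤ M` on the circle (the kernel has mass one and is
  `≤ (R² - |w-c|²)/(η/2)²` away from `ζ`);
* `continuousOn_discPoisson`, **`harmonicContOnCl_discPoisson`**, `discPoisson_eq_of_mem_sphere`,
  and the packaged existence statement **`exists_harmonicContOnCl_eqOn_sphere`**.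

Everything is proved, [folklore].
-/

noncomputable section

namespace Literature.Analysis.Complex

open _root_.Complex Metric Set Filter Real InnerProductSpace
open scoped Topology

open Classical in
/-- **The Poisson integral** of the boundary datum `φ` on the disc `B(c, R)`: inside the open disc
the circle average of `P(w, ·) φ`, elsewhere `φ` itself. [folklore] -/
def discPoisson (c : ℂ) (R : ℝ) (φ : ℂ → ℝ) (w : ℂ) : ℝ :=
  if w ∈ ball c R then circleAverage (fun z => poissonKernel c w z * φ z) c R else φ w

variable {c : ℂ} {R : ℝ} {φ : ℂ → ℝ}

/-- Inside the open disc the Poisson integral is the circle average of `P(w,·) φ`. [folklore] -/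
theorem discPoisson_eq_of_mem_ball {w : ℂ} (hw : w ∈ ball c R) :
    discPoisson c R φ w = circleAverage (fun z => poissonKernel c w z * φ z) c R := by
  unfold discPoisson; rw [if_pos hw]

/-- Off the open disc the Poisson integral is the datum. [folklore] -/
theorem discPoisson_eq_of_not_mem_ball {w : ℂ} (hw : w ∉ ball c R) : discPoisson c R φ w = φ w := by
  unfold discPoisson; rw [if_neg hw]

/-- On the circle the Poisson integral is the datum. [folklore] -/
theorem discPoisson_eq_of_mem_sphere {w : ℂ} (hw : w ∈ sphere c R) : discPoisson c R φ w = φ w := by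
  apply discPoisson_eq_of_not_mem_ball
  rw [mem_sphere] at hw
  rw [mem_ball, hw]
  exact lt_irrefl _

/-- A point of the circle is not in the open disc's "denominator-free" zone: `z - w ≠ 0` for
`|z - c| = R`, `|w - c| < R`. [folklore] -/
theorem sub_ne_zero_of_mem_sphere_of_mem_ball {z w : ℂ} (hz : z ∈ sphere c R) (hw : w ∈ ball c R) :
    z - w ≠ 0 := by
  intro h
  rw [sub_eq_zero] at h
  subst h
  rw [mem_sphere] at hz
  rw [mem_ball, hz] at hw
  exact lt_irrefl _ hw

/-- The Poisson kernel written with the denominator `|z - w|²`. [folklore] -/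
theorem poissonKernel_eq (c w z : ℂ) :
    poissonKernel c w z = (‖z - c‖ ^ 2 - ‖w - c‖ ^ 2) / ‖z - w‖ ^ 2 := by
  rw [poissonKernel_def]
  congr 2
  ring

/-- The Poisson kernel is nonnegative (`|w - c| < R = |z - c|`). [folklore] -/
theorem poissonKernel_nonneg' {z w : ℂ} (hz : z ∈ sphere c R) (hw : w ∈ ball c R) :
    0 ≤ poissonKernel c w z := by
  rw [poissonKernel_eq]
  refine div_nonneg ?_ (sq_nonneg _)
  rw [mem_sphere, dist_eq_norm] at hz
  rw [mem_ball, dist_eq_norm] at hw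
  rw [hz, sub_nonneg]
  exact pow_le_pow_left₀ (norm_nonneg _) hw.le 2

/-- Continuity of the Poisson kernel on the circle, for a pole inside. [folklore] -/
theorem continuousOn_poissonKernel {w : ℂ} (hw : w ∈ ball c R) :
    ContinuousOn (fun z => poissonKernel c w z) (sphere c R) := by
  intro z hz
  have hne := sub_ne_zero_of_mem_sphere_of_mem_ball hz hw
  simp_rw [poissonKernel_eq]
  refine ContinuousAt.continuousWithinAt ?_
  exact ContinuousAt.div (by fun_prop) (by fun_prop) (pow_ne_zero 2 (norm_ne_zero_iff.mpr hne))

/-- Continuity on the circle of `P(w, ·) ψ` for `ψ` continuous on the circle. [folklore] -/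
theorem continuousOn_poissonKernel_mul {w : ℂ} (hw : w ∈ ball c R) {ψ : ℂ → ℝ}
    (hψ : ContinuousOn ψ (sphere c R)) :
    ContinuousOn (fun z => poissonKernel c w z * ψ z) (sphere c R) :=
  (continuousOn_poissonKernel hw).mul hψ

/-- **The Poisson kernel has mass one**: `avg_{|z-c|=R} P(w, z) = 1` for `|w - c| < R`
(Mathlib's Poisson formula for the constant function `1`). [folklore] -/
theorem circleAverage_poissonKernel {w : ℂ} (hw : w ∈ ball c R) :
    circleAverage (fun z => poissonKernel c w z) c R = 1 := by
  have h := (harmonicContOnCl_const (c := (1 : ℝ)) (s := ball c R)).circleAverage_poissonKernel_smul hw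
  have e : (poissonKernel c w • fun _ : ℂ => (1 : ℝ)) = fun z => poissonKernel c w z := by
    funext z; simp [Pi.smul_apply']
  rwa [e] at h

/-! ### Harmonicity: the Poisson integral is the real part of a Cauchy integral -/

/-- The holomorphic companion: `F(w) = 2 (2πi)⁻¹ ∮ φ(z) (z-w)⁻¹ dz - avg φ`. [folklore] -/
def discCauchy (c : ℂ) (R : ℝ) (φ : ℂ → ℝ) (w : ℂ) : ℂ :=
  2 * ((2 * π * I)⁻¹ • ∮ z in C(c, R), (z - w)⁻¹ • ((φ z : ℝ) : ℂ)) -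
    circleAverage (fun z => ((φ z : ℝ) : ℂ)) c R

/-- The companion is analytic on the open disc (power series of Cauchy integrals). [folklore] -/
theorem analyticOnNhd_discCauchy (hR : 0 < R) (hφ : ContinuousOn φ (sphere c R)) :
    AnalyticOnNhd ℂ (discCauchy c R φ) (ball c R) := by
  have hφc : ContinuousOn (fun z => ((φ z : ℝ) : ℂ)) (sphere c R) :=
    continuous_ofReal.comp_continuousOn hφ
  have hci : CircleIntegrable (fun z => ((φ z : ℝ) : ℂ)) c R := hφc.circleIntegrable hR.le
  lift R to NNReal using hR.le
  have hR' : (0 : NNReal) < R := by exact_mod_cast hR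
  have hps := hasFPowerSeriesOn_cauchy_integral hci hR'
  have han : AnalyticOnNhd ℂ
      (fun w => (2 * π * I : ℂ)⁻¹ • ∮ z in C(c, R), (z - w)⁻¹ • ((φ z : ℝ) : ℂ)) (ball c R) := by
    intro w hw
    have hw' : w ∈ Metric.eball c R := by
      rw [Metric.eball_coe]; exact hw
    exact hps.analyticAt_of_mem hw'
  intro w hw
  unfold discCauchy
  exact ((analyticAt_const.mul (han w hw)).sub analyticAt_const)

/-- Inside the disc, `avg (K(w,·) φ) = F(w)` where `K` is the Herglotz–Riesz kernel:
`K(w, z) = 2(z-c)/(z-w) - 1` on the circle and `avg((z-c) g(z)) = (2πi)⁻¹ ∮ g`. [folklore] -/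
theorem circleAverage_herglotz_mul_eq_discCauchy (hR : 0 < R) (hφ : ContinuousOn φ (sphere c R))
    {w : ℂ} (hw : w ∈ ball c R) :
    circleAverage (fun z => herglotzRieszKernel c w z * ((φ z : ℝ) : ℂ)) c R = discCauchy c R φ w := by
  have hφc : ContinuousOn (fun z => ((φ z : ℝ) : ℂ)) (sphere c R) :=
    continuous_ofReal.comp_continuousOn hφ
  -- split the kernel on the circle
  set g : ℂ → ℂ := fun z => (z - c) * ((z - w)⁻¹ • ((φ z : ℝ) : ℂ)) with hg_def
  have hsplit : EqOn (fun z => herglotzRieszKernel c w z * ((φ z : ℝ) : ℂ))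
      (fun z => (2 : ℂ) • g z - ((φ z : ℝ) : ℂ)) (sphere c |R|) := by
    intro z hz
    rw [abs_of_pos hR] at hz
    have hne := sub_ne_zero_of_mem_sphere_of_mem_ball hz hw
    simp only [herglotzRieszKernel_def, smul_eq_mul, hg_def]
    have : z - c - (w - c) = z - w := by ring
    rw [this]
    field_simp
    ring
  rw [circleAverage_congr_sphere hsplit]
  have hg : ContinuousOn g (sphere c R) := by
    intro z hz
    have hne := sub_ne_zero_of_mem_sphere_of_mem_ball hz hw
    simp only [hg_def]
    simp only [smul_eq_mul]
    refine ContinuousWithinAt.mul (by fun_prop) ?_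
    refine ContinuousWithinAt.mul ?_ (hφc z hz)
    exact (continuousWithinAt_id.sub continuousWithinAt_const).inv₀ hne
  have hgi : CircleIntegrable g c R := hg.circleIntegrable hR.le
  have hgi2 : CircleIntegrable (fun z : ℂ => (2 : ℂ) • g z) c R := hgi.const_fun_smul
  rw [circleAverage_fun_sub hgi2 (hφc.circleIntegrable hR.le), circleAverage_fun_smul,
    circleAverage_eq_circleIntegral hR.ne']
  unfold discCauchy
  congr 2
  rw [smul_eq_mul]
  congr 1
  refine circleIntegral.integral_congr hR.le fun z hz => ?_
  have hzc : z - c ≠ 0 := by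
    intro h; rw [sub_eq_zero] at h; subst h
    rw [mem_sphere, dist_self] at hz; exact hR.ne' hz.symm
  simp only [hg_def, smul_eq_mul]
  field_simp

/-- **Inside the disc the Poisson integral is `Re F`.** [folklore] -/
theorem discPoisson_eq_re (hR : 0 < R) (hφ : ContinuousOn φ (sphere c R)) {w : ℂ} (hw : w ∈ ball c R) :
    discPoisson c R φ w = (discCauchy c R φ w).re := by
  rw [discPoisson_eq_of_mem_ball hw, ← circleAverage_herglotz_mul_eq_discCauchy hR hφ hw]
  have hφc : ContinuousOn (fun z => ((φ z : ℝ) : ℂ)) (sphere c R) :=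
    continuous_ofReal.comp_continuousOn hφ
  have hK : ContinuousOn (fun z => herglotzRieszKernel c w z * ((φ z : ℝ) : ℂ)) (sphere c R) := by
    intro z hz
    have hne := sub_ne_zero_of_mem_sphere_of_mem_ball hz hw
    refine ContinuousWithinAt.mul ?_ (hφc z hz)
    have hne' : z - c - (w - c) ≠ 0 := by
      have : z - c - (w - c) = z - w := by ring
      rwa [this]
    unfold herglotzRieszKernel
    exact ((continuousWithinAt_id.sub continuousWithinAt_const).add continuousWithinAt_const).div
      ((continuousWithinAt_id.sub continuousWithinAt_const).sub continuousWithinAt_const) hne'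
  have key := ContinuousLinearMap.circleAverage_comp_comm reCLM (hK.circleIntegrable hR.le)
  rw [reCLM_apply] at key
  rw [← key]
  apply circleAverage_congr_sphere
  intro z hz
  simp only [Function.comp_apply, reCLM_apply, mul_re, ofReal_re, ofReal_im, mul_zero, sub_zero]
  rw [poissonKernel_eq_re_herglotzRieszKernel]
  rfl

/-- **The Poisson integral is harmonic in the open disc.** [folklore] -/
theorem harmonicOnNhd_discPoisson (hR : 0 < R) (hφ : ContinuousOn φ (sphere c R)) :
    HarmonicOnNhd (discPoisson c R φ) (ball c R) := by
  intro w hw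
  have han := analyticOnNhd_discCauchy hR hφ w hw
  have hev : discPoisson c R φ =ᶠ[𝓝 w] fun w => (discCauchy c R φ w).re := by
    filter_upwards [isOpen_ball.mem_nhds hw] with w' hw'
    exact discPoisson_eq_re hR hφ hw'
  rw [harmonicAt_congr_nhds hev]
  exact han.harmonicAt_re

/-! ### Boundary behaviour: the approximate-identity estimate -/

/-- Pointwise bound behind the approximate identity: on the circle,
`P(w,z)|φ z - φ ζ| ≤ ε P(w,z) + 2M (R² - |w-c|²)/(η/2)²` when `|φ - φ ζ| ≤ ε` within `η` of `ζ`,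
`|φ| ≤ M` on the circle and `|w - ζ| ≤ η/2`. [folklore] -/
theorem poissonKernel_mul_abs_sub_le {w ζ z : ℂ} (hw : w ∈ ball c R) (hz : z ∈ sphere c R)
    (hζ : ζ ∈ sphere c R) {ε η M : ℝ} (hη : 0 < η) (hM : ∀ z ∈ sphere c R, |φ z| ≤ M)
    (hε : ∀ z ∈ sphere c R, dist z ζ < η → |φ z - φ ζ| ≤ ε) (hwζ : dist w ζ ≤ η / 2) :
    poissonKernel c w z * |φ z - φ ζ| ≤
      ε * poissonKernel c w z + 2 * M * ((R ^ 2 - ‖w - c‖ ^ 2) / (η / 2) ^ 2) := by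
  have hP0 := poissonKernel_nonneg' hz hw
  have hM0 : 0 ≤ M := (abs_nonneg _).trans (hM ζ hζ)
  have hR2 : 0 ≤ R ^ 2 - ‖w - c‖ ^ 2 := by
    rw [mem_ball, dist_eq_norm] at hw
    have : ‖w - c‖ ^ 2 ≤ R ^ 2 := by
      have hR : 0 ≤ R := (norm_nonneg _).trans hw.le
      exact pow_le_pow_left₀ (norm_nonneg _) hw.le 2
    linarith
  have hB0 : 0 ≤ 2 * M * ((R ^ 2 - ‖w - c‖ ^ 2) / (η / 2) ^ 2) := by positivity
  by_cases hnear : dist z ζ < η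
  · have h1 := hε z hz hnear
    calc poissonKernel c w z * |φ z - φ ζ| ≤ poissonKernel c w z * ε :=
          mul_le_mul_of_nonneg_left h1 hP0
      _ = ε * poissonKernel c w z := mul_comm _ _
      _ ≤ _ := le_add_of_nonneg_right hB0
  · push Not at hnear
    have hεnn : 0 ≤ ε := by
      have := hε ζ hζ (by rw [dist_self]; exact hη)
      rw [sub_self, abs_zero] at this
      exact this
    have h2M : |φ z - φ ζ| ≤ 2 * M := by
      calc |φ z - φ ζ| ≤ |φ z| + |φ ζ| := abs_sub _ _
        _ ≤ M + M := add_le_add (hM z hz) (hM ζ hζ)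
        _ = 2 * M := by ring
    -- the kernel is small away from `ζ`
    have hzw : η / 2 ≤ ‖z - w‖ := by
      have h1 : dist z ζ ≤ dist z w + dist w ζ := dist_triangle _ _ _
      rw [dist_eq_norm z w] at h1
      linarith
    have hPle : poissonKernel c w z ≤ (R ^ 2 - ‖w - c‖ ^ 2) / (η / 2) ^ 2 := by
      rw [poissonKernel_eq]
      rw [mem_sphere, dist_eq_norm] at hz
      rw [hz]
      have hden : 0 < ‖z - w‖ ^ 2 := by
        have : 0 < ‖z - w‖ := lt_of_lt_of_le (by positivity) hzw
        positivity
      rw [div_le_div_iff₀ hden (by positivity)]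
      have : (η / 2) ^ 2 ≤ ‖z - w‖ ^ 2 := pow_le_pow_left₀ (by positivity) hzw 2
      exact mul_le_mul_of_nonneg_left this hR2
    calc poissonKernel c w z * |φ z - φ ζ| ≤ (R ^ 2 - ‖w - c‖ ^ 2) / (η / 2) ^ 2 * (2 * M) :=
          mul_le_mul hPle h2M (abs_nonneg _) (by positivity)
      _ = 2 * M * ((R ^ 2 - ‖w - c‖ ^ 2) / (η / 2) ^ 2) := by ring
      _ ≤ _ := le_add_of_nonneg_left (mul_nonneg hεnn hP0)

/-- **Approximate identity.** With `ε, η, M` as above and `|w - ζ| ≤ η/2`, `|w - c| < R`: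
`|u(w) - φ(ζ)| ≤ ε + 8M (R² - |w-c|²)/η²`. [folklore] -/
theorem abs_discPoisson_sub_le (hR : 0 < R) (hφ : ContinuousOn φ (sphere c R)) {w ζ : ℂ}
    (hw : w ∈ ball c R) (hζ : ζ ∈ sphere c R) {ε η M : ℝ} (hη : 0 < η)
    (hM : ∀ z ∈ sphere c R, |φ z| ≤ M) (hε : ∀ z ∈ sphere c R, dist z ζ < η → |φ z - φ ζ| ≤ ε)
    (hwζ : dist w ζ ≤ η / 2) :
    |discPoisson c R φ w - φ ζ| ≤ ε + 2 * M * ((R ^ 2 - ‖w - c‖ ^ 2) / (η / 2) ^ 2) := by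
  set B := 2 * M * ((R ^ 2 - ‖w - c‖ ^ 2) / (η / 2) ^ 2) with hB
  have hPc := continuousOn_poissonKernel (c := c) (R := R) hw
  have hi1 : CircleIntegrable (fun z => poissonKernel c w z * φ z) c R :=
    (continuousOn_poissonKernel_mul hw hφ).circleIntegrable hR.le
  have hi2 : CircleIntegrable (fun z => poissonKernel c w z * φ ζ) c R :=
    (hPc.mul continuousOn_const).circleIntegrable hR.le
  -- `u(w) - φ ζ = avg (P (φ - φ ζ))`
  have hdiff : discPoisson c R φ w - φ ζ =
      circleAverage (fun z => poissonKernel c w z * (φ z - φ ζ)) c R := by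
    rw [discPoisson_eq_of_mem_ball hw]
    have h1 : circleAverage (fun z => poissonKernel c w z * φ ζ) c R = φ ζ := by
      have := circleAverage_fun_smul (c := c) (R := R) (a := φ ζ) (f := fun z => poissonKernel c w z)
      simp only [smul_eq_mul] at this
      rw [show (fun z => poissonKernel c w z * φ ζ) = fun z => φ ζ * poissonKernel c w z from
        funext fun z => mul_comm _ _, this, circleAverage_poissonKernel hw, mul_one]
    simp_rw [mul_sub]
    rw [circleAverage_fun_sub hi1 hi2, h1]
  rw [hdiff]
  -- bound the average by the average of the pointwise bound
  have hi3 : CircleIntegrable (fun z => poissonKernel c w z * (φ z - φ ζ)) c R :=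
    (hPc.mul (hφ.sub continuousOn_const)).circleIntegrable hR.le
  have hi4 : CircleIntegrable (fun z => |poissonKernel c w z * (φ z - φ ζ)|) c R := hi3.abs
  have hi5 : CircleIntegrable (fun z => ε * poissonKernel c w z + B) c R :=
    ((continuousOn_const.mul hPc).add continuousOn_const).circleIntegrable hR.le
  calc |circleAverage (fun z => poissonKernel c w z * (φ z - φ ζ)) c R|
      ≤ circleAverage |fun z => poissonKernel c w z * (φ z - φ ζ)| c R :=
        abs_circleAverage_le_circleAverage_abs
    _ ≤ circleAverage (fun z => ε * poissonKernel c w z + B) c R := by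
        refine circleAverage_mono hi4 hi5 fun z hz => ?_
        rw [abs_of_pos hR] at hz
        simp only [Pi.abs_apply, abs_mul, abs_of_nonneg (poissonKernel_nonneg' hz hw)]
        exact poissonKernel_mul_abs_sub_le hw hz hζ hη hM hε hwζ
    _ = ε + B := by
        have hi6 : CircleIntegrable (fun z => ε * poissonKernel c w z) c R :=
          (continuousOn_const.mul hPc).circleIntegrable hR.le
        have hi7 : CircleIntegrable (fun _ : ℂ => B) c R := continuousOn_const.circleIntegrable hR.le
        rw [circleAverage_fun_add hi6 hi7, circleAverage_const]
        have := circleAverage_fun_smul (c := c) (R := R) (a := ε) (f := fun z => poissonKernel c w z)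
        simp only [smul_eq_mul] at this
        rw [this, circleAverage_poissonKernel hw, mul_one]

/-- `R² - |w-c|² ≤ 2R |w - ζ|` for `|ζ - c| = R`, `|w - c| < R`. [folklore] -/
theorem sq_sub_sq_le {w ζ : ℂ} (hw : w ∈ ball c R) (hζ : ζ ∈ sphere c R) :
    R ^ 2 - ‖w - c‖ ^ 2 ≤ 2 * R * dist w ζ := by
  rw [mem_ball, dist_eq_norm] at hw
  rw [mem_sphere, dist_eq_norm] at hζ
  have hR : 0 ≤ R := (norm_nonneg _).trans hw.le
  have h1 : R ≤ dist w ζ + ‖w - c‖ := by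
    rw [← hζ, dist_eq_norm]
    calc ‖ζ - c‖ = ‖(w - c) - (w - ζ)‖ := by ring_nf
      _ ≤ ‖w - c‖ + ‖w - ζ‖ := norm_sub_le _ _
      _ = ‖w - ζ‖ + ‖w - c‖ := add_comm _ _
  have h2 : R ^ 2 - ‖w - c‖ ^ 2 = (R - ‖w - c‖) * (R + ‖w - c‖) := by ring
  rw [h2]
  calc (R - ‖w - c‖) * (R + ‖w - c‖) ≤ dist w ζ * (R + ‖w - c‖) :=
        mul_le_mul_of_nonneg_right (by linarith) (by positivity)
    _ ≤ dist w ζ * (2 * R) := mul_le_mul_of_nonneg_left (by linarith) dist_nonneg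
    _ = 2 * R * dist w ζ := by ring

/-- **Boundary values**: `u(w) → φ(ζ)` as `w → ζ` within the closed disc, at every point `ζ` of
the circle. [folklore] -/
theorem tendsto_discPoisson (hR : 0 < R) (hφ : ContinuousOn φ (sphere c R)) {ζ : ℂ}
    (hζ : ζ ∈ sphere c R) :
    Tendsto (discPoisson c R φ) (𝓝[closedBall c R] ζ) (𝓝 (φ ζ)) := by
  -- a bound for `φ` on the circle
  obtain ⟨M, hM⟩ : ∃ M, ∀ z ∈ sphere c R, |φ z| ≤ M := by
    obtain ⟨M, hM⟩ := (isCompact_sphere c R).exists_bound_of_continuousOn hφ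
    exact ⟨M, fun z hz => by simpa [Real.norm_eq_abs] using hM z hz⟩
  have hM0 : 0 ≤ M := (abs_nonneg _).trans (hM ζ hζ)
  rw [Metric.tendsto_nhdsWithin_nhds]
  intro ε hε
  -- continuity of `φ` at `ζ` along the circle
  obtain ⟨η, hη, hηφ⟩ : ∃ η > 0, ∀ z ∈ sphere c R, dist z ζ < η → |φ z - φ ζ| ≤ ε / 3 := by
    have := Metric.continuousWithinAt_iff.1 (hφ ζ hζ) (ε / 3) (by positivity)
    obtain ⟨η, hη, h⟩ := this
    exact ⟨η, hη, fun z hz hd => by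
      have := h hz hd
      rw [Real.dist_eq] at this
      exact this.le⟩
  -- the radius
  set δ := min (η / 2) (ε / 3 * (η / 2) ^ 2 / (2 * M + 1) / (2 * R)) with hδ
  have hδpos : 0 < δ := by
    rw [hδ]; refine lt_min (by positivity) ?_; positivity
  refine ⟨δ, hδpos, fun w hw hwζ => ?_⟩
  by_cases hwb : w ∈ ball c R
  · have hwζ' : dist w ζ ≤ η / 2 := hwζ.le.trans (min_le_left _ _)
    have hest := abs_discPoisson_sub_le hR hφ hwb hζ hη hM hηφ hwζ'
    rw [Real.dist_eq]
    have hsq := sq_sub_sq_le hwb hζ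
    have hB : 2 * M * ((R ^ 2 - ‖w - c‖ ^ 2) / (η / 2) ^ 2) ≤ ε / 3 := by
      have hd : dist w ζ < ε / 3 * (η / 2) ^ 2 / (2 * M + 1) / (2 * R) :=
        lt_of_lt_of_le hwζ (min_le_right _ _)
      have h1 : R ^ 2 - ‖w - c‖ ^ 2 ≤ 2 * R * (ε / 3 * (η / 2) ^ 2 / (2 * M + 1) / (2 * R)) :=
        hsq.trans (mul_le_mul_of_nonneg_left hd.le (by positivity))
      have h2 : 2 * R * (ε / 3 * (η / 2) ^ 2 / (2 * M + 1) / (2 * R)) =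
          ε / 3 * (η / 2) ^ 2 / (2 * M + 1) := by field_simp
      rw [h2] at h1
      have hη2 : (0 : ℝ) < (η / 2) ^ 2 := by positivity
      calc 2 * M * ((R ^ 2 - ‖w - c‖ ^ 2) / (η / 2) ^ 2)
          ≤ 2 * M * ((ε / 3 * (η / 2) ^ 2 / (2 * M + 1)) / (η / 2) ^ 2) := by
            gcongr
        _ = 2 * M / (2 * M + 1) * (ε / 3) := by field_simp
        _ ≤ 1 * (ε / 3) := by
            refine mul_le_mul_of_nonneg_right ?_ (by positivity)
            rw [div_le_one (by positivity)]; linarith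
        _ = ε / 3 := one_mul _
    linarith
  · -- `w` on the circle: `u w = φ w`
    have hws : w ∈ sphere c R := by
      rw [mem_closedBall] at hw
      rw [mem_ball, not_lt] at hwb
      exact mem_sphere.2 (le_antisymm hw hwb)
    rw [discPoisson_eq_of_not_mem_ball hwb, Real.dist_eq]
    have hwζ' : dist w ζ < η := lt_of_lt_of_le hwζ ((min_le_left _ _).trans (by linarith))
    linarith [hηφ w hws hwζ']

/-- **The Poisson integral is continuous on the closed disc.** [folklore] -/
theorem continuousOn_discPoisson (hR : 0 < R) (hφ : ContinuousOn φ (sphere c R)) :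
    ContinuousOn (discPoisson c R φ) (closedBall c R) := by
  intro w hw
  by_cases hwb : w ∈ ball c R
  · have hc : ContinuousAt (discPoisson c R φ) w :=
      ((harmonicOnNhd_discPoisson hR hφ w hwb).1.continuousAt)
    exact hc.continuousWithinAt
  · have hws : w ∈ sphere c R := by
      rw [mem_closedBall] at hw
      rw [mem_ball, not_lt] at hwb
      exact mem_sphere.2 (le_antisymm hw hwb)
    have h := tendsto_discPoisson hR hφ hws
    rw [ContinuousWithinAt, discPoisson_eq_of_mem_sphere hws]
    exact h

/-- **Solution of the Dirichlet problem on a disc** (Mathlib's packaging `HarmonicContOnCl`):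
the Poisson integral of continuous data is harmonic in the disc and continuous on its closure.
[folklore] -/
theorem harmonicContOnCl_discPoisson (hR : 0 < R) (hφ : ContinuousOn φ (sphere c R)) :
    HarmonicContOnCl (discPoisson c R φ) (ball c R) :=
  HarmonicContOnCl.mk_ball (harmonicOnNhd_discPoisson hR hφ) (continuousOn_discPoisson hR hφ)

/-- **Existence for the Dirichlet problem on a disc**: continuous data on the circle `|z-c| = R`
(`R > 0`) are the boundary values of a function harmonic in the open disc and continuous on the
closed disc. (Uniqueness is Mathlib's `HarmonicContOnCl.circleAverage_poissonKernel_smul`.)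
[folklore] -/
theorem exists_harmonicContOnCl_eqOn_sphere (hR : 0 < R) (hφ : ContinuousOn φ (sphere c R)) :
    ∃ u : ℂ → ℝ, HarmonicContOnCl u (ball c R) ∧ EqOn u φ (sphere c R) :=
  ⟨discPoisson c R φ, harmonicContOnCl_discPoisson hR hφ, fun _ hw => discPoisson_eq_of_mem_sphere hw⟩

end Literature.Analysis.Complex
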